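import Summits.QuantumFields.BalabanUV.T4Continuum.Support.AveragingDeficitFermat
import Summits.QuantumFields.BalabanUV.T4Continuum.Support.NE3EnergyHessBilin
import Summits.QuantumFields.BalabanUV.T4Continuum.Support.NE3TangentCovariantTower
import Summits.QuantumFields.BalabanUV.T4Continuum.Support.NE3SmoothRightInverseFlat
import Summits.QuantumFields.BalabanUV.T4Continuum.Support.NE3FramePotBoundComplex
import Summits.QuantumFields.BalabanUV.T4Continuum.Support.NE3FlatHessianCurl
import Summits.QuantumFields.BalabanUV.T4Continuum.Support.NE3SmoothLiftCurl
import HarnessLib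

/-!
# NE7FlatSliceNormalForm — row NE7 (node U5), the (A)-bill's END at the trivial flat datum: THE SLICE IDENTITY OF THE SOLVER LETTER `G♭`
# IN NORMAL FORM — the flat curl of a slice solution is UNIQUE (so a supplier may bound the curl of HIS solution), and the slice identity
# is a LAGRANGE identity on ALL skew periodic fields with a multiplier through the flat linearised average `dirIter L j 1`

Lineage `b2b-balaban-t4-ne7-p2` (CRUX PROVER NE7 #2, co-owner of row NE7), generation 84; companion of (137) `NE7FlatSliceSourceDuality` (the `ℓ¹–ℓ^∞`
duality socket of `G♭`).  Over `NE3HessForm.hess` ∕ `NE3EnergyHessBilin.hessBilin`, the exact flat Hessian `NE3FlatHessianCurl.hess_flatCfg_eq_sum_nhsNormSq`,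
`NE3SmoothLiftCurl.curlAt_flat_eq`, `NE3TangentCovariantTower.dirIter_flat` with the linearity of B7's contour averages
(`NE3SmoothRightInverseFlat.iterate_Tcoarse_add`, `NE3FramePotBoundComplex.iterate_Tcoarse_map`), the torus index of `AveragingDeficitTorusChart`, Mathlib.
WHY.  After (137), every supplier of the END's slice solver letter `G♭` (F54 v3's `hG`; the XL(c) driver) has to prove the SOURCE form: for `X` in the
slice `V = {skew, P-periodic, dirIter L j 1 · = 0}` with `hess 1 X Y (perWin d P) = ℓ Y` for all `Y ∈ V` (`ℓ = ⟨H, ·⟩` a source pairing), bound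
`‖curl 1 X‖_∞`.  A Green's-function supplier (lit-balaban B5's `G`, `G₀` and the (1.132)–(1.133) transfer, or any other) does NOT receive `X`: he
CONSTRUCTS a solution `X'` of the same slice identity from his propagator and bounds `curl 1 X'`.  Two pieces of bookkeeping make that enough, once and for
all: (N1) **UNIQUENESS OF THE FLAT CURL ON THE SLICE** — two slice solutions of the same identity have the same flat curl EVERYWHERE
(**`curlAt_flat_eq_of_sliceIdentity`**; core **`curlAt_flat_eq_zero_of_hess_self_eq_zero`**: a skew `P`-periodic `D` with `hess 1 D D (perWin d P) = 0` has
`curl 1 D ≡ 0`, by the exact flat Hessian `= Σ ‖curl‖²_{HS}∕n` and periodicity); (N2) **THE LAGRANGE NORMAL FORM** — the slice identity, an identity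
on `V` only, is EQUIVALENT to an identity on ALL skew `P`-periodic `Y` with a multiplier through the constraint map:
`hess 1 X Y = ℓ Y + μ (dirIter L j 1 Y)` for one real linear functional `μ` (**`exists_multiplier_of_sliceIdentity`**, and the trivial converse
**`sliceIdentity_of_multiplier`**) — the form in which a propagator with the averaging constraint built in (B5's `Q*`-terms) is applied.
HOW ([folklore]).  §1 (Mathlib only) **`exists_factor_of_ker_le`**: a functional killing `U ∩ ker T` factors through `T` on the subspace `U`
(`Submodule.liftQ` ∕ `LinearMap.quotKerEquivRange` on `U`, then `LinearMap.exists_extend` from the range to the whole target).  §2 the flat linearised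
average as a real LINEAR MAP **`dirIterFlatL`** and the subspace **`skewPeriodicDir P`** of skew `P`-periodic fields.  §3 (N1).  §4 (N2).
HONEST FRAMING (page 1): [folklore] finite-dimensional bookkeeping; NO estimate is proved; the `k`-uniform constant of `G♭` (XL(c), PRICING-NE7 v64: critical,
unprinted ∕ unproved) is NOT touched; nothing of Bałaban's asserted; NOT (APE), NOT ONE-STEP, NOT NE7; spine 0∕9; finite T⁴ rung (B)+1 — NOT infinite
volume, NOT mass gap, NOT Clay.  Continuum YM on T⁴ ⇐ BetaPertH ∧ nine spine estimates (0/9 proved); BetaPertH ⇐ (D1) ∧ (D4) ∧ CAP+tail; G-an2-4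
gates asym, D1 and NE2/3/4.
-/

set_option autoImplicit false

open scoped BigOperators Matrix Matrix.Norms.L2Operator
open NormedSpace Finset

namespace Summit.QuantumFields.BalabanUV.T4Continuum.NE7FlatSliceNormalForm

/-! ## §1 Factorisation of a functional through a linear map on a subspace (Mathlib only) -/

section Factor

variable {K V W : Type*} [Field K] [AddCommGroup V] [Module K V] [AddCommGroup W] [Module K W]

/-- **A functional that kills `U ∩ ker T` factors through `T` on `U`**: if `ℓ v = 0` whenever `v ∈ U` and `T v = 0`, then `ℓ v = μ (T v)` on `U` for one
linear functional `μ` on the target (Lagrange multipliers in linear algebra). [folklore] -/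
theorem exists_factor_of_ker_le (U : Submodule K V) (T : V →ₗ[K] W) (ℓ : V →ₗ[K] K) (h : ∀ v ∈ U, T v = 0 → ℓ v = 0) :
    ∃ μ : W →ₗ[K] K, ∀ v ∈ U, ℓ v = μ (T v) := by
  -- restrict to `U`
  set TU : U →ₗ[K] W := T ∘ₗ U.subtype with hTU
  set ℓU : U →ₗ[K] K := ℓ ∘ₗ U.subtype with hℓU
  have hker : LinearMap.ker TU ≤ LinearMap.ker ℓU := by
    intro u hu
    rw [LinearMap.mem_ker] at hu ⊢
    exact h u u.2 hu
  -- factor through the quotient by the kernel ≅ the range, then extend from the range to `W`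
  set μ₀ : LinearMap.range TU →ₗ[K] K := (LinearMap.ker TU).liftQ ℓU hker ∘ₗ TU.quotKerEquivRange.symm.toLinearMap with hμ₀
  obtain ⟨μ, hμ⟩ := LinearMap.exists_extend μ₀
  refine ⟨μ, fun v hv => ?_⟩
  have hmem : T v ∈ LinearMap.range TU := ⟨⟨v, hv⟩, rfl⟩
  have h1 : μ (T v) = μ₀ ⟨T v, hmem⟩ := by
    rw [← hμ]; rfl
  have h2 : μ₀ ⟨T v, hmem⟩ = ℓ v := by
    have e : (⟨T v, hmem⟩ : LinearMap.range TU) = ⟨TU ⟨v, hv⟩, hmem⟩ := rfl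
    rw [hμ₀, LinearMap.comp_apply, e]
    show (LinearMap.ker TU).liftQ ℓU hker (TU.quotKerEquivRange.symm ⟨TU ⟨v, hv⟩, hmem⟩) = ℓ v
    rw [LinearMap.quotKerEquivRange_symm_apply_image, Submodule.mkQ_apply, Submodule.liftQ_apply]
    rfl
  rw [h1, h2]

end Factor

/-! ## §2 The flat linearised average as a real linear map; the subspace of skew periodic direction fields -/

open Literature.MathematicalPhysics.QuantumFieldTheory.Balaban1983to89
open B7Prop1Explicit B7Prop2Explicit UnitaryModel MatrixNorms
open T4AveragingDeficitWall hiding Site Plane Plaq Bond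
open T4AveragingDeficitWallBoundary (IsPeriodicCfg periodBox)
open AveragingDeficitPeriodicCounting (IsPeriodicDir curl_add_period)
open MinimalActionLevels (perWin)
open MinimalActionWitness (flatCfg)
open BlockAveragePushDirSplit (flat)
open SmoothRefineNeutral (Tcoarse)
open NE3HessForm (hess)
open NE3TangentCovariantTower (dirIter dirIter_flat)
open NE3EnergyHessBilin (hessBilin hessBilin_apply)
open NE3FlatHessianCurl (hess_flatCfg_eq_sum_nhsNormSq flatCfg_eq_one)
open NE3SmoothLiftCurl (curlAt_flat_eq)
open AveragingDeficitTorusChart (redN redN_boxVec eq_wrap_add periodic_smul_vec)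
open AveragingDeficitFermat (boxVec_redN_mem)

noncomputable section

variable {d : ℕ} {n : Type*} [Fintype n] [DecidableEq n]

local notation "𝕄" => Matrix n n ℂ

/-- **THE `j`-FOLD FLAT LINEARISED AVERAGE `dirIter L j 1` AS A REAL LINEAR MAP** (`= (Tcoarse L)^[j]` by `dirIter_flat`; additive by
`iterate_Tcoarse_add`, real-homogeneous by `iterate_Tcoarse_map` at the `ℂ`-linear map `(c : ℂ) • id`). [folklore] -/
def dirIterFlatL {L : ℕ} (hL : 1 ≤ L) (j : ℕ) : (Site d → Fin d → 𝕄) →ₗ[ℝ] (Site d → Fin d → 𝕄) where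
  toFun Y := dirIter L j (flat (d := d) (n := n)) Y
  map_add' Y Z := by
    rw [dirIter_flat hL, dirIter_flat hL, dirIter_flat hL]
    exact NE3SmoothRightInverseFlat.iterate_Tcoarse_add L j Y Z
  map_smul' c Y := by
    have e : (fun y μ => ((c : ℂ) • (LinearMap.id : 𝕄 →ₗ[ℂ] 𝕄)) (Y y μ)) = c • Y := by
      funext y μ; ext i k
      simp only [LinearMap.smul_apply, LinearMap.id_coe, id_eq, Pi.smul_apply, Matrix.smul_apply, Complex.real_smul, smul_eq_mul]
    have h := NE3FramePotBoundComplex.iterate_Tcoarse_map ((c : ℂ) • (LinearMap.id : 𝕄 →ₗ[ℂ] 𝕄)) L j Y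
    rw [e] at h
    rw [RingHom.id_apply, dirIter_flat hL, dirIter_flat hL, h]
    funext z κ; ext i k
    simp only [LinearMap.smul_apply, LinearMap.id_coe, id_eq, Pi.smul_apply, Matrix.smul_apply, Complex.real_smul, smul_eq_mul]

/-- unfolding. [folklore] -/
@[simp] theorem dirIterFlatL_apply {L : ℕ} (hL : 1 ≤ L) (j : ℕ) (Y : Site d → Fin d → 𝕄) :
    dirIterFlatL (d := d) (n := n) hL j Y = dirIter L j (flat (d := d) (n := n)) Y := rfl

/-- **THE SKEW `P`-PERIODIC DIRECTION FIELDS** (the periodic tangent space at `1`) as a real subspace. [folklore] -/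
def skewPeriodicDir (P : ℕ) : Submodule ℝ (Site d → Fin d → 𝕄) where
  carrier := {Y | IsSkewDir Y ∧ IsPeriodicDir Y (P : ℤ)}
  add_mem' := by
    rintro Y Z ⟨hYs, hYP⟩ ⟨hZs, hZP⟩
    refine ⟨fun x κ => (skewAdjoint 𝕄).add_mem (hYs x κ) (hZs x κ), fun x κ μ => ?_⟩
    show Y (x + (P : ℤ) • e κ) μ + Z (x + (P : ℤ) • e κ) μ = Y x μ + Z x μ
    rw [hYP, hZP]
  zero_mem' := ⟨fun x κ => (skewAdjoint 𝕄).zero_mem, fun x κ μ => rfl⟩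
  smul_mem' := by
    rintro c Y ⟨hYs, hYP⟩
    refine ⟨fun x κ => skewAdjoint.smul_mem c (hYs x κ), fun x κ μ => ?_⟩
    show c • Y (x + (P : ℤ) • e κ) μ = c • Y x μ
    rw [hYP]

omit [Fintype n] [DecidableEq n] in
/-- membership unfolding. [folklore] -/
theorem mem_skewPeriodicDir (P : ℕ) (Y : Site d → Fin d → 𝕄) :
    Y ∈ skewPeriodicDir (d := d) (n := n) P ↔ IsSkewDir Y ∧ IsPeriodicDir Y (P : ℤ) := Iff.rfl

/-! ## §3 (N1) Uniqueness of the flat curl on the slice -/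

/-- A matrix with vanishing normalised Hilbert–Schmidt square vanishes. [folklore] -/
theorem eq_zero_of_nhsNormSq_eq_zero {M : 𝕄} (h : nhsNormSq M = 0) : M = 0 := by
  have h2 := opNorm_sq_le_card_mul_nhsNormSq M
  rw [h, mul_zero] at h2
  exact norm_eq_zero.mp (by nlinarith [norm_nonneg M])

/-- **A SKEW `P`-PERIODIC FIELD WITH VANISHING FLAT HESSIAN SELF-PAIRING OVER ONE PERIOD WINDOW HAS VANISHING FLAT CURL EVERYWHERE**:
`hess 1 D D (perWin d P) = Σ_{p ∈ perWin} ‖curl 1 D p‖²_{HS}∕n` (`hess_flatCfg_eq_sum_nhsNormSq`) kills the curl on the window; periodicity and the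
antisymmetry of the flat curl in the plane indices carry it to every plaquette. [folklore] -/
theorem curlAt_flat_eq_zero_of_hess_self_eq_zero {P : ℕ} [NeZero P] {D : Site d → Fin d → 𝕄} (hDs : IsSkewDir D)
    (hDP : IsPeriodicDir D (P : ℤ)) (h0 : hess (flat (d := d) (n := n)) D D (perWin d P) = 0) (z : Site d) (μ ν : Fin d) :
    curlAt (flat (d := d) (n := n)) D z μ ν = 0 := by
  -- the curl vanishes on the period window
  have hflat : (flat (d := d) (n := n)) = flatCfg := by rw [flatCfg_eq_one]
  have hwin : ∀ p ∈ perWin d P, curl (flat (d := d) (n := n)) D p = 0 := by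
    rw [hflat, hess_flatCfg_eq_sum_nhsNormSq hDs] at h0
    intro p hp
    have hp0 : nhsNormSq (curl (flat (d := d) (n := n)) D p) = 0 := by
      rw [hflat]
      exact (Finset.sum_eq_zero_iff_of_nonneg fun q _ => nhsNormSq_nonneg _).mp h0 p hp
    exact eq_zero_of_nhsNormSq_eq_zero hp0
  -- periodicity of the flat curl along the period lattice
  have hper : ∀ (π : T4AveragingDeficitWall.Plane d),
      curl (flat (d := d) (n := n)) D (z, π) = curl (flat (d := d) (n := n)) D (boxVec P (redN P z), π) := by
    intro π
    have hV : IsPeriodicCfg (flat (d := d) (n := n)) (P : ℤ) := fun _ _ _ => rfl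
    conv_lhs => rw [eq_wrap_add P z]
    exact periodic_smul_vec (f := fun y => curl (flat (d := d) (n := n)) D (y, π)) (fun y κ => curl_add_period hV hDP y κ π) _ _
  have hmem : ∀ (π : T4AveragingDeficitWall.Plane d), (boxVec P (redN P z), π) ∈ perWin d P := fun π =>
    Finset.mem_product.mpr ⟨boxVec_redN_mem P z, Finset.mem_univ _⟩
  rcases lt_trichotomy μ ν with hlt | heq | hgt
  · have e : curlAt (flat (d := d) (n := n)) D z μ ν = curl (flat (d := d) (n := n)) D (z, ⟨(μ, ν), hlt⟩) := rfl
    rw [e, hper, hwin _ (hmem _)]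
  · subst heq
    rw [curlAt_flat_eq]
    abel
  · have e : curlAt (flat (d := d) (n := n)) D z μ ν = -curl (flat (d := d) (n := n)) D (z, ⟨(ν, μ), hgt⟩) := by
      show curlAt _ D z μ ν = -curlAt _ D z ν μ
      rw [curlAt_flat_eq, curlAt_flat_eq]
      abel
    rw [e, hper, hwin _ (hmem _), neg_zero]

/-- **(N1) UNIQUENESS OF THE FLAT CURL ON THE SLICE**: two fields `X, X'` of the slice `{skew, P-periodic, dirIter L j 1 · = 0}` whose flat Hessian
functionals agree on the slice (here: both equal to the same real functional `ℓ`, e.g. a source pairing) have the same flat curl at every plaquette.  So a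
supplier of `G♭` may bound the curl of ANY solution he constructs. [folklore] -/
theorem curlAt_flat_eq_of_sliceIdentity {L : ℕ} (hL : 1 ≤ L) (j P : ℕ) [NeZero P] (ℓ : (Site d → Fin d → 𝕄) → ℝ)
    {X X' : Site d → Fin d → 𝕄} (hXs : IsSkewDir X) (hXP : IsPeriodicDir X (P : ℤ)) (hXT : dirIter L j (flat (d := d) (n := n)) X = 0)
    (hX's : IsSkewDir X') (hX'P : IsPeriodicDir X' (P : ℤ)) (hX'T : dirIter L j (flat (d := d) (n := n)) X' = 0)
    (hX : ∀ Y : Site d → Fin d → 𝕄, IsSkewDir Y → IsPeriodicDir Y (P : ℤ) → dirIter L j (flat (d := d) (n := n)) Y = 0 →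
      hess (flat (d := d) (n := n)) X Y (perWin d P) = ℓ Y)
    (hX' : ∀ Y : Site d → Fin d → 𝕄, IsSkewDir Y → IsPeriodicDir Y (P : ℤ) → dirIter L j (flat (d := d) (n := n)) Y = 0 →
      hess (flat (d := d) (n := n)) X' Y (perWin d P) = ℓ Y)
    (z : Site d) (μ ν : Fin d) : curlAt (flat (d := d) (n := n)) X z μ ν = curlAt (flat (d := d) (n := n)) X' z μ ν := by
  -- the difference `D = X − X'` lies in the slice
  have hDmem : X - X' ∈ skewPeriodicDir (d := d) (n := n) P :=
    (skewPeriodicDir P).sub_mem (show X ∈ skewPeriodicDir P from ⟨hXs, hXP⟩) (show X' ∈ skewPeriodicDir P from ⟨hX's, hX'P⟩)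
  have hDT : dirIter L j (flat (d := d) (n := n)) (X - X') = 0 := by
    rw [← dirIterFlatL_apply hL, map_sub, dirIterFlatL_apply, dirIterFlatL_apply, hXT, hX'T, sub_zero]
  -- its Hessian self-pairing vanishes
  have h0 : hess (flat (d := d) (n := n)) (X - X') (X - X') (perWin d P) = 0 := by
    have e := map_sub (hessBilin (flat (d := d) (n := n)) (perWin d P)) X X'
    have e2 : hess (flat (d := d) (n := n)) (X - X') (X - X') (perWin d P)
        = hess (flat (d := d) (n := n)) X (X - X') (perWin d P) - hess (flat (d := d) (n := n)) X' (X - X') (perWin d P) := by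
      rw [← hessBilin_apply, e, LinearMap.sub_apply, hessBilin_apply, hessBilin_apply]
    rw [e2, hX _ hDmem.1 hDmem.2 hDT, hX' _ hDmem.1 hDmem.2 hDT, sub_self]
  have h := curlAt_flat_eq_zero_of_hess_self_eq_zero hDmem.1 hDmem.2 h0 z μ ν
  have e : curlAt (flat (d := d) (n := n)) (X - X') z μ ν
      = curlAt (flat (d := d) (n := n)) X z μ ν - curlAt (flat (d := d) (n := n)) X' z μ ν := by
    rw [sub_eq_add_neg X X', NE3EnergyHessBilin.curlAt_add, ← neg_one_smul ℝ X', NE3EnergyHessBilin.curlAt_smul, neg_one_smul,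
      ← sub_eq_add_neg]
  rw [e] at h
  exact sub_eq_zero.mp h

/-- **(N1′) WITNESS TRANSFER** — the form in which a Green's-function supplier discharges a source bound: if for the given slice solution `X` of the
identity with right-hand side `ℓ` he PRODUCES some slice solution `X'` of the same identity whose flat curl he bounds by `B` at `(z; μ, ν)`, then the flat
curl of `X` itself obeys the bound. [folklore] -/
theorem norm_curlAt_flat_le_of_witness {L : ℕ} (hL : 1 ≤ L) (j P : ℕ) [NeZero P] (ℓ : (Site d → Fin d → 𝕄) → ℝ)
    {X X' : Site d → Fin d → 𝕄} (hXs : IsSkewDir X) (hXP : IsPeriodicDir X (P : ℤ)) (hXT : dirIter L j (flat (d := d) (n := n)) X = 0)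
    (hX's : IsSkewDir X') (hX'P : IsPeriodicDir X' (P : ℤ)) (hX'T : dirIter L j (flat (d := d) (n := n)) X' = 0)
    (hX : ∀ Y : Site d → Fin d → 𝕄, IsSkewDir Y → IsPeriodicDir Y (P : ℤ) → dirIter L j (flat (d := d) (n := n)) Y = 0 →
      hess (flat (d := d) (n := n)) X Y (perWin d P) = ℓ Y)
    (hX' : ∀ Y : Site d → Fin d → 𝕄, IsSkewDir Y → IsPeriodicDir Y (P : ℤ) → dirIter L j (flat (d := d) (n := n)) Y = 0 →
      hess (flat (d := d) (n := n)) X' Y (perWin d P) = ℓ Y)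
    {z : Site d} {μ ν : Fin d} {B : ℝ} (hB : ‖curlAt (flat (d := d) (n := n)) X' z μ ν‖ ≤ B) :
    ‖curlAt (flat (d := d) (n := n)) X z μ ν‖ ≤ B := by
  rw [curlAt_flat_eq_of_sliceIdentity hL j P ℓ hXs hXP hXT hX's hX'P hX'T hX hX' z μ ν]
  exact hB

/-! ## §4 (N2) The Lagrange normal form of the slice identity -/

/-- **(N2) THE LAGRANGE NORMAL FORM**: if the flat Hessian functional of `X` agrees with a real linear functional `ℓ` on the slice
`{skew, P-periodic, dirIter L j 1 · = 0}`, then on ALL skew `P`-periodic `Y` it reads `hess 1 X Y (perWin d P) = ℓ Y + μ (dirIter L j 1 Y)` for one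
real linear functional `μ` (the multiplier, through the constraint map). [folklore] -/
theorem exists_multiplier_of_sliceIdentity {L : ℕ} (hL : 1 ≤ L) (j P : ℕ) (X : Site d → Fin d → 𝕄)
    (ℓ : (Site d → Fin d → 𝕄) →ₗ[ℝ] ℝ) (W : Finset (T4AveragingDeficitWall.Plaq d))
    (hX : ∀ Y : Site d → Fin d → 𝕄, IsSkewDir Y → IsPeriodicDir Y (P : ℤ) → dirIter L j (flat (d := d) (n := n)) Y = 0 →
      hess (flat (d := d) (n := n)) X Y W = ℓ Y) :
    ∃ μ : (Site d → Fin d → 𝕄) →ₗ[ℝ] ℝ, ∀ Y : Site d → Fin d → 𝕄, IsSkewDir Y → IsPeriodicDir Y (P : ℤ) →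
      hess (flat (d := d) (n := n)) X Y W = ℓ Y + μ (dirIter L j (flat (d := d) (n := n)) Y) := by
  obtain ⟨μ, hμ⟩ := exists_factor_of_ker_le (skewPeriodicDir (d := d) (n := n) P) (dirIterFlatL (d := d) (n := n) hL j)
    (hessBilin (flat (d := d) (n := n)) W X - ℓ) (fun Y hY hT => by
      rw [LinearMap.sub_apply, hessBilin_apply, hX Y hY.1 hY.2 hT, sub_self])
  refine ⟨μ, fun Y hYs hYP => ?_⟩
  have h := hμ Y ⟨hYs, hYP⟩
  rw [LinearMap.sub_apply, hessBilin_apply, dirIterFlatL_apply] at h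
  linarith

/-- **The converse of (N2)**: a Lagrange identity on all skew `P`-periodic fields restricts to the slice identity. [folklore] -/
theorem sliceIdentity_of_multiplier {L : ℕ} (j P : ℕ) (X : Site d → Fin d → 𝕄) (ℓ : (Site d → Fin d → 𝕄) → ℝ)
    (μ : (Site d → Fin d → 𝕄) →ₗ[ℝ] ℝ) (W : Finset (T4AveragingDeficitWall.Plaq d))
    (h : ∀ Y : Site d → Fin d → 𝕄, IsSkewDir Y → IsPeriodicDir Y (P : ℤ) →
      hess (flat (d := d) (n := n)) X Y W = ℓ Y + μ (dirIter L j (flat (d := d) (n := n)) Y)) :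
    ∀ Y : Site d → Fin d → 𝕄, IsSkewDir Y → IsPeriodicDir Y (P : ℤ) → dirIter L j (flat (d := d) (n := n)) Y = 0 →
      hess (flat (d := d) (n := n)) X Y W = ℓ Y := by
  intro Y hYs hYP hT
  rw [h Y hYs hYP, hT, map_zero, add_zero]

/-- **THE SLICE IDENTITY DETERMINES THE MULTIPLIER TERM**: two Lagrange forms of the same Hessian functional with the same `ℓ` have multipliers that
agree on the range of the constraint map over skew periodic fields. [folklore] -/
theorem multiplier_unique_on_range {L : ℕ} (j P : ℕ) (X : Site d → Fin d → 𝕄) (ℓ : (Site d → Fin d → 𝕄) → ℝ)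
    (μ μ' : (Site d → Fin d → 𝕄) →ₗ[ℝ] ℝ) (W : Finset (T4AveragingDeficitWall.Plaq d))
    (h : ∀ Y : Site d → Fin d → 𝕄, IsSkewDir Y → IsPeriodicDir Y (P : ℤ) →
      hess (flat (d := d) (n := n)) X Y W = ℓ Y + μ (dirIter L j (flat (d := d) (n := n)) Y))
    (h' : ∀ Y : Site d → Fin d → 𝕄, IsSkewDir Y → IsPeriodicDir Y (P : ℤ) →
      hess (flat (d := d) (n := n)) X Y W = ℓ Y + μ' (dirIter L j (flat (d := d) (n := n)) Y)) :
    ∀ Y : Site d → Fin d → 𝕄, IsSkewDir Y → IsPeriodicDir Y (P : ℤ) →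
      μ (dirIter L j (flat (d := d) (n := n)) Y) = μ' (dirIter L j (flat (d := d) (n := n)) Y) := by
  intro Y hYs hYP
  have e := h Y hYs hYP
  rw [h' Y hYs hYP] at e
  linarith

end

end Summit.QuantumFields.BalabanUV.T4Continuum.NE7FlatSliceNormalForm
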